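import Mathlib.Analysis.SpecialFunctions.Sqrt
import Mathlib.Analysis.Calculus.ContDiff.Operations
import Mathlib.Analysis.Normed.Group.Bounded
import Mathlib.Algebra.BigOperators.Fin
import Mathlib.Data.Fin.VecNotation
import HarnessLib

/-!
# Nash's rank-one decomposition of symmetric `3 × 3` matrices near the identity
(Coiculescu–Palasek 2025, Lemma 6.1 "Nash lemma"; a convex-integration tool)

First proved brick (a leaf of the DAG recorded in
`Literature/Barriers/NavierStokesRegularity/CriticalDataSmoothNonuniqueness.lean`'s discharge
plan) of M. P. Coiculescu, S. Palasek, *Non-uniqueness of smooth solutions of the Navier–Stokes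
equations from critical data*, Invent. Math. 244 (2025) 165–219 = arXiv:2503.14699
(`CoiculescuPalasek2025`). Their App. A ("Tools from convex integration"), Lemma 6.1, printed:

> **Lemma 6.1 (Nash lemma).** There exist `c₀ > 0`, `θ₁, …, θ₆ ∈ ℤ³`, and
> `Γ₁, …, Γ₆ ∈ C^∞(B; ℝ)` such that `M = ∑_{j=1}^{6} Γ_j(M)² θ_j ⊗ θ_j` for all `M ∈ B`, where
> `B = B(Id, c₀)` is the closed ball of radius `c₀` centered at the identity in `S^{3×3}`. The
> `Γ_j` obey the estimates `1/100 ≤ Γ_j ≤ 1 ∀ M ∈ B` and `‖∇^m Γ_j‖_{L^∞(B)} ≲_m 1` for all `m ≥ 1`.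

with the explicit proof data `θ₁ = (0,0,1)`, `θ₂ = (2,0,1)`, `θ₃ = (1,1,1)`, `θ₄ = (-1,1,1)`,
`θ₅ = (-2,0,1)`, `θ₆ = (0,-2,1)`, `c₀ = 1/1000`, and, writing `ε = M - Id`,
`Γ₁² = 1/3 - ε₁₁/4 - 5ε₂₂/12 - ε₂₃/3 + ε₃₃`, `Γ₂² = 1/12 + ε₁₁/8 - ε₁₂/4 + ε₁₃/4 - ε₂₂/24 - ε₂₃/12`,
`Γ₃² = 1/6 + ε₁₂/2 + ε₂₂/6 + ε₂₃/3`, `Γ₄² = 1/6 - ε₁₂/2 + ε₂₂/6 + ε₂₃/3`,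
`Γ₅² = 1/12 + ε₁₁/8 + ε₁₂/4 - ε₁₃/4 - ε₂₂/24 - ε₂₃/12`, `Γ₆² = 1/6 + ε₂₂/6 - ε₂₃/6`
(the idea is Nash's, *C¹ isometric imbeddings*, Ann. of Math. 60 (1954)). In the paper the
`θ_j` are the directions of the Mikado pipes of the initial datum (Def. 3.1) and the `Γ_j` enter
the amplitudes `a_{j,k}` of the data iteration (Def. 3.5); §3.1 also fixes `η_j ∈ ℤ³ ∖ 0` with
`θ_j · η_j = 0`.

Everything here is **proved** (no named facts):

* `CP25.nashDir j = θ_j`, `CP25.nashNormal j = η_j` (an explicit choice, `nashDir_dot_nashNormal`,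
  `nashNormal_ne_zero`), `CP25.nashCoeffSq M j = Γ_j(M)²` (the six affine functionals above),
  `CP25.nashCoeff j M = Γ_j(M) = √(Γ_j(M)²)`, `CP25.nashRadius = c₀ = 1/1000`;
* `CP25.nash_identity`: `M = ∑_j Γ_j(M)² θ_j ⊗ θ_j` holds for **every** symmetric `M` (it is a
  linear identity; the ball is only needed for the square roots);
* `CP25.nashCoeffSq_mem_Icc`, `CP25.nashCoeff_mem_Icc`: `1/100 ≤ Γ_j² ≤ 1` and
  `1/10 ≤ Γ_j ≤ 1` on the closed ball of radius `2c₀ = 1/500`;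
* `CP25.nash_decomposition`: `M = ∑_j Γ_j(M)² θ_j ⊗ θ_j` with `Γ_j = nashCoeff j`, on that ball;
* `CP25.contDiff_nashCoeffSq`, `CP25.contDiffOn_nashCoeff`: `Γ_j²` is `C^∞` everywhere and
  `Γ_j` is `C^∞` on the closed ball of radius `2c₀` (a neighbourhood of `B`);
* `CP25.exists_bound_iteratedFDeriv_nashCoeff`: `sup_B ‖D^m Γ_j‖ < ∞` for every `m`;
* `CP25.nash_lemma`: Lemma 6.1 in its printed quantifier shape.

## Design

* `S^{3×3}` is rendered inside the Pi type `Fin 3 → Fin 3 → ℝ` (sup norm, the instance under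
  which `ContDiff`/`iteratedFDeriv` are canonical) with a symmetry hypothesis
  `∀ i j, M i j = M j i`; the identity matrix is `CP25.idMat`. The printed ball is the Frobenius
  ball of `S^{3×3}`; since every entry is bounded by the Frobenius norm, the Frobenius ball of
  radius `c₀` lies inside the sup-norm ball `dist M idMat ≤ c₀` used here, and all conclusions are
  proved on the larger sup-ball of radius `2c₀` — so the statements below contain the printed
  ones.
* `θ_j ⊗ θ_j` is written entrywise, `(θ_j ⊗ θ_j)_{ab} = θ_{ja} θ_{jb}` (integer entries cast to `ℝ`).

## References

* M. P. Coiculescu, S. Palasek, Invent. Math. 244 (2025) 165–219, arXiv:2503.14699, App. A,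
  Lemma 6.1 and its proof (p. 21 of the arXiv version); §3.1 (the `η_j`). [`CoiculescuPalasek2025`]
* J. Nash, *C¹ isometric imbeddings*, Ann. of Math. 60 (1954) 383–396 (origin of the device).
-/

noncomputable section

open Set Metric
open scoped ContDiff

namespace Literature.Analysis.FluidPDE.CP25

/-! ## The data of the lemma -/

/-- The identity matrix `Id ∈ ℝ^{3×3}`, as an element of the Pi type `Fin 3 → Fin 3 → ℝ`.
[cite: CoiculescuPalasek2025, Lemma 6.1] -/
def idMat : Fin 3 → Fin 3 → ℝ := fun i j => if i = j then 1 else 0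

/-- Diagonal entries of `Id` are `1`. [folklore] -/
@[simp] theorem idMat_apply_self (i : Fin 3) : idMat i i = 1 := by simp [idMat]

/-- Off-diagonal entries of `Id` are `0`. [folklore] -/
theorem idMat_apply_of_ne {i j : Fin 3} (h : i ≠ j) : idMat i j = 0 := by simp [idMat, h]

/-- `Id₀₁ = 0`. [folklore] -/
@[simp] theorem idMat_zero_one : idMat 0 1 = 0 := idMat_apply_of_ne (by decide)

/-- `Id₀₂ = 0`. [folklore] -/
@[simp] theorem idMat_zero_two : idMat 0 2 = 0 := idMat_apply_of_ne (by decide)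

/-- `Id₁₂ = 0`. [folklore] -/
@[simp] theorem idMat_one_two : idMat 1 2 = 0 := idMat_apply_of_ne (by decide)

/-- `Id₁₀ = 0`. [folklore] -/
@[simp] theorem idMat_one_zero : idMat 1 0 = 0 := idMat_apply_of_ne (by decide)

/-- `Id₂₀ = 0`. [folklore] -/
@[simp] theorem idMat_two_zero : idMat 2 0 = 0 := idMat_apply_of_ne (by decide)

/-- `Id₂₁ = 0`. [folklore] -/
@[simp] theorem idMat_two_one : idMat 2 1 = 0 := idMat_apply_of_ne (by decide)

/-- `idMat` is symmetric. [folklore] -/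
theorem idMat_symm (i j : Fin 3) : idMat i j = idMat j i := by
  fin_cases i <;> fin_cases j <;> simp

/-- Nash's six integer directions `θ₁ = (0,0,1)`, `θ₂ = (2,0,1)`, `θ₃ = (1,1,1)`, `θ₄ = (-1,1,1)`,
`θ₅ = (-2,0,1)`, `θ₆ = (0,-2,1)` (indexed by `Fin 6`, `nashDir 0 = θ₁`, …).
[cite: CoiculescuPalasek2025, Lemma 6.1 (proof)] -/
def nashDir : Fin 6 → Fin 3 → ℤ :=
  ![![0, 0, 1], ![2, 0, 1], ![1, 1, 1], ![-1, 1, 1], ![-2, 0, 1], ![0, -2, 1]]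

/-- An explicit choice of nonzero integer vectors `η_j` orthogonal to `θ_j` (§3.1 of the paper
only requires `η_j ∈ ℤ³ ∖ 0`, `θ_j · η_j = 0`): `η₁ = (1,0,0)`, `η₂ = (1,0,-2)`, `η₃ = (1,-1,0)`,
`η₄ = (1,1,0)`, `η₅ = (1,0,2)`, `η₆ = (1,0,0)`. [cite: CoiculescuPalasek2025, §3.1] -/
def nashNormal : Fin 6 → Fin 3 → ℤ :=
  ![![1, 0, 0], ![1, 0, -2], ![1, -1, 0], ![1, 1, 0], ![1, 0, 2], ![1, 0, 0]]

/-- `θ_j · η_j = 0`. [cite: CoiculescuPalasek2025, §3.1] -/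
theorem nashDir_dot_nashNormal (j : Fin 6) : ∑ i, nashDir j i * nashNormal j i = 0 := by
  fin_cases j <;> simp [nashDir, nashNormal, Fin.sum_univ_three]

/-- The first coordinate of every `η_j` is `1`. [cite: CoiculescuPalasek2025, §3.1] -/
@[simp] theorem nashNormal_apply_zero (j : Fin 6) : nashNormal j 0 = 1 := by
  fin_cases j <;> simp [nashNormal]

/-- `η_j ≠ 0`. [cite: CoiculescuPalasek2025, §3.1] -/
theorem nashNormal_ne_zero (j : Fin 6) : nashNormal j ≠ 0 := by
  intro h
  have := congrFun h 0
  simp at this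

/-- The third coordinate of every `θ_j` is `1`; in particular `θ_j ≠ 0`.
[cite: CoiculescuPalasek2025, Lemma 6.1 (proof)] -/
@[simp] theorem nashDir_apply_two (j : Fin 6) : nashDir j 2 = 1 := by
  fin_cases j <;> simp [nashDir]

/-- `θ_j ≠ 0`. [cite: CoiculescuPalasek2025, Lemma 6.1] -/
theorem nashDir_ne_zero (j : Fin 6) : nashDir j ≠ 0 := by
  intro h
  have := congrFun h 2
  simp at this

/-- The squared Nash coefficients `Γ_j(M)²`, the six affine functionals of `ε = M - Id` printed in
the proof of Lemma 6.1 (with `ε₁₁ = M₀₀ - 1`, `ε₂₂ = M₁₁ - 1`, `ε₃₃ = M₂₂ - 1`, `ε₁₂ = M₀₁`,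
`ε₁₃ = M₀₂`, `ε₂₃ = M₁₂`; only upper-triangular entries are used, `M` being symmetric):
`Γ₁² = 1/3 - ε₁₁/4 - 5ε₂₂/12 - ε₂₃/3 + ε₃₃`, `Γ₂² = 1/12 + ε₁₁/8 - ε₁₂/4 + ε₁₃/4 - ε₂₂/24 - ε₂₃/12`,
`Γ₃² = 1/6 + ε₁₂/2 + ε₂₂/6 + ε₂₃/3`, `Γ₄² = 1/6 - ε₁₂/2 + ε₂₂/6 + ε₂₃/3`,
`Γ₅² = 1/12 + ε₁₁/8 + ε₁₂/4 - ε₁₃/4 - ε₂₂/24 - ε₂₃/12`, `Γ₆² = 1/6 + ε₂₂/6 - ε₂₃/6`.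
[cite: CoiculescuPalasek2025, Lemma 6.1 (proof)] -/
def nashCoeffSq (M : Fin 3 → Fin 3 → ℝ) : Fin 6 → ℝ :=
  ![1 / 3 - (M 0 0 - 1) / 4 - 5 * (M 1 1 - 1) / 12 - M 1 2 / 3 + (M 2 2 - 1),
    1 / 12 + (M 0 0 - 1) / 8 - M 0 1 / 4 + M 0 2 / 4 - (M 1 1 - 1) / 24 - M 1 2 / 12,
    1 / 6 + M 0 1 / 2 + (M 1 1 - 1) / 6 + M 1 2 / 3,
    1 / 6 - M 0 1 / 2 + (M 1 1 - 1) / 6 + M 1 2 / 3,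
    1 / 12 + (M 0 0 - 1) / 8 + M 0 1 / 4 - M 0 2 / 4 - (M 1 1 - 1) / 24 - M 1 2 / 12,
    1 / 6 + (M 1 1 - 1) / 6 - M 1 2 / 6]

/-- The Nash coefficients `Γ_j(M) = √(Γ_j(M)²)` (the positive square roots; meaningful where
`Γ_j(M)² > 0`, in particular on the ball `B(Id, 2c₀)`). [cite: CoiculescuPalasek2025, Lemma 6.1] -/
def nashCoeff (j : Fin 6) (M : Fin 3 → Fin 3 → ℝ) : ℝ := Real.sqrt (nashCoeffSq M j)

/-- The radius `c₀ = 1/1000` of Lemma 6.1. [cite: CoiculescuPalasek2025, Lemma 6.1 (proof)] -/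
def nashRadius : ℝ := 1 / 1000

/-- `c₀ > 0`. [cite: CoiculescuPalasek2025, Lemma 6.1] -/
theorem nashRadius_pos : 0 < nashRadius := by norm_num [nashRadius]

/-! ## The linear identity -/

/-- **Nash's identity** `M_{ab} = ∑_j Γ_j(M)² θ_{ja} θ_{jb}` for every symmetric `M` (a linear
identity in the entries of `M`; no smallness is needed at the level of `Γ_j²`).
[cite: CoiculescuPalasek2025, Lemma 6.1 (proof: "One can verify that the claim holds if …")] -/
theorem nash_identity {M : Fin 3 → Fin 3 → ℝ} (hsym : ∀ i j, M i j = M j i) (a b : Fin 3) :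
    M a b = ∑ j, nashCoeffSq M j * ((nashDir j a : ℝ) * (nashDir j b : ℝ)) := by
  have h10 := hsym 1 0
  have h20 := hsym 2 0
  have h21 := hsym 2 1
  fin_cases a <;> fin_cases b <;>
    simp [Fin.sum_univ_six, nashCoeffSq, nashDir] <;> linarith

/-! ## Bounds on the ball `B(Id, 2c₀)` -/

/-- Entries of a matrix in the sup-ball `dist M Id ≤ r` are within `r` of those of `Id`. [folklore] -/
theorem abs_sub_idMat_le {M : Fin 3 → Fin 3 → ℝ} {r : ℝ} (hM : dist M idMat ≤ r) (i j : Fin 3) :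
    |M i j - idMat i j| ≤ r := by
  have h := (dist_le_pi_dist (M i) (idMat i) j).trans ((dist_le_pi_dist M idMat i).trans hM)
  rwa [Real.dist_eq] at h

/-- **`1/100 ≤ Γ_j(M)² ≤ 1` on the sup-ball of radius `2c₀ = 1/500` around `Id`** (hence on the
printed Frobenius ball `B(Id, c₀)`): each `Γ_j²` is `1/12`, `1/6` or `1/3` plus a combination of
entries of `ε = M - Id` with coefficients of total size `≤ 2`.
[cite: CoiculescuPalasek2025, Lemma 6.1 (proof: "each of these expressions is bigger than 1/100")] -/
theorem nashCoeffSq_mem_Icc {M : Fin 3 → Fin 3 → ℝ} (hM : dist M idMat ≤ 1 / 500) (j : Fin 6) :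
    1 / 100 ≤ nashCoeffSq M j ∧ nashCoeffSq M j ≤ 1 := by
  obtain ⟨h00l, h00u⟩ := abs_le.mp (abs_sub_idMat_le hM 0 0)
  obtain ⟨h11l, h11u⟩ := abs_le.mp (abs_sub_idMat_le hM 1 1)
  obtain ⟨h22l, h22u⟩ := abs_le.mp (abs_sub_idMat_le hM 2 2)
  obtain ⟨h01l, h01u⟩ := abs_le.mp (abs_sub_idMat_le hM 0 1)
  obtain ⟨h02l, h02u⟩ := abs_le.mp (abs_sub_idMat_le hM 0 2)
  obtain ⟨h12l, h12u⟩ := abs_le.mp (abs_sub_idMat_le hM 1 2)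
  simp only [idMat_apply_self, idMat_zero_one, idMat_zero_two, idMat_one_two, sub_zero] at *
  fin_cases j <;> simp [nashCoeffSq] <;> constructor <;> linarith

/-- `Γ_j(M)² > 0` on the ball of radius `2c₀`. [cite: CoiculescuPalasek2025, Lemma 6.1] -/
theorem nashCoeffSq_pos {M : Fin 3 → Fin 3 → ℝ} (hM : dist M idMat ≤ 1 / 500) (j : Fin 6) :
    0 < nashCoeffSq M j := by
  linarith [(nashCoeffSq_mem_Icc hM j).1]

/-- **`1/10 ≤ Γ_j(M) ≤ 1` on the sup-ball of radius `2c₀` around `Id`** (the paper records the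
weaker `1/100 ≤ Γ_j ≤ 1`). [cite: CoiculescuPalasek2025, Lemma 6.1 (Gammabound)] -/
theorem nashCoeff_mem_Icc {M : Fin 3 → Fin 3 → ℝ} (hM : dist M idMat ≤ 1 / 500) (j : Fin 6) :
    1 / 10 ≤ nashCoeff j M ∧ nashCoeff j M ≤ 1 := by
  obtain ⟨hl, hu⟩ := nashCoeffSq_mem_Icc hM j
  refine ⟨?_, ?_⟩
  · rw [nashCoeff, show (1 / 10 : ℝ) = Real.sqrt (1 / 100) by
      rw [show (1 / 100 : ℝ) = (1 / 10) ^ 2 by norm_num, Real.sqrt_sq (by norm_num)]]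
    exact Real.sqrt_le_sqrt hl
  · rw [nashCoeff, ← Real.sqrt_one]
    exact Real.sqrt_le_sqrt hu

/-- `Γ_j(M)² = (Γ_j(M))²` on the ball (the square root is genuine there). [cite: CoiculescuPalasek2025, Lemma 6.1] -/
theorem nashCoeff_sq {M : Fin 3 → Fin 3 → ℝ} (hM : dist M idMat ≤ 1 / 500) (j : Fin 6) :
    nashCoeff j M ^ 2 = nashCoeffSq M j :=
  Real.sq_sqrt (nashCoeffSq_pos hM j).le

/-- **Nash's rank-one decomposition** `M_{ab} = ∑_{j=1}^6 Γ_j(M)² θ_{ja} θ_{jb}` for every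
symmetric `M` in the sup-ball of radius `2c₀ = 1/500` around `Id` (which contains the printed
Frobenius ball `B(Id, c₀)`, `c₀ = 1/1000`). [cite: CoiculescuPalasek2025, Lemma 6.1] -/
theorem nash_decomposition {M : Fin 3 → Fin 3 → ℝ} (hsym : ∀ i j, M i j = M j i)
    (hM : dist M idMat ≤ 1 / 500) (a b : Fin 3) :
    M a b = ∑ j, nashCoeff j M ^ 2 * ((nashDir j a : ℝ) * (nashDir j b : ℝ)) := by
  rw [nash_identity hsym a b]
  exact Finset.sum_congr rfl fun j _ => by rw [nashCoeff_sq hM j]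

/-! ## Smoothness -/

/-- Each `Γ_j²` is `C^∞` on all of `ℝ^{3×3}` (an affine function of the entries). [cite: CoiculescuPalasek2025, Lemma 6.1] -/
theorem contDiff_nashCoeffSq (j : Fin 6) {n : WithTop ℕ∞} :
    ContDiff ℝ n fun M : Fin 3 → Fin 3 → ℝ => nashCoeffSq M j := by
  have h : ∀ a b : Fin 3, ContDiff ℝ n fun M : Fin 3 → Fin 3 → ℝ => M a b :=
    fun a b => contDiff_apply_apply ℝ ℝ a b
  fin_cases j <;> simp [nashCoeffSq] <;> fun_prop

/-- **Each `Γ_j` is `C^∞` on the closed sup-ball of radius `2c₀` around `Id`** (a neighbourhood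
of the printed ball `B`; the square root of a smooth function bounded below by `1/100`).
[cite: CoiculescuPalasek2025, Lemma 6.1 (`Γ_j ∈ C^∞(B; ℝ)`)] -/
theorem contDiffOn_nashCoeff (j : Fin 6) {n : WithTop ℕ∞} :
    ContDiffOn ℝ n (nashCoeff j) (closedBall idMat (1 / 500)) :=
  (contDiff_nashCoeffSq j).contDiffOn.sqrt fun _ hM => (nashCoeffSq_pos (mem_closedBall.mp hM) j).ne'

/-- `Γ_j` is `C^∞` at every point of the open sup-ball of radius `2c₀`. [cite: CoiculescuPalasek2025, Lemma 6.1] -/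
theorem contDiffAt_nashCoeff (j : Fin 6) {n : WithTop ℕ∞} {M : Fin 3 → Fin 3 → ℝ}
    (hM : dist M idMat < 1 / 500) : ContDiffAt ℝ n (nashCoeff j) M :=
  (contDiffOn_nashCoeff j).contDiffAt
    (Filter.mem_of_superset (isOpen_ball.mem_nhds (mem_ball.mpr hM)) ball_subset_closedBall)

/-- **Uniform bounds on all derivatives of `Γ_j` on `B`**: for every `m` there is `C` with
`‖D^m Γ_j(M)‖ ≤ C` for all `M` in the closed sup-ball of radius `c₀` (continuity of `D^m Γ_j` on
the open ball of radius `2c₀` and compactness of the closed ball of radius `c₀`; the paper's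
`‖∇^m Γ_j‖_{L^∞(B)} ≲_m 1`). [cite: CoiculescuPalasek2025, Lemma 6.1 (GammaboundII)] -/
theorem exists_bound_iteratedFDeriv_nashCoeff (j : Fin 6) (m : ℕ) :
    ∃ C : ℝ, ∀ M : Fin 3 → Fin 3 → ℝ, dist M idMat ≤ nashRadius →
      ‖iteratedFDeriv ℝ m (nashCoeff j) M‖ ≤ C := by
  -- `Γ_j` is smooth on the open ball `U` of radius `2c₀`
  set U : Set (Fin 3 → Fin 3 → ℝ) := ball idMat (1 / 500) with hU
  have hUopen : IsOpen U := isOpen_ball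
  have hsmooth : ContDiffOn ℝ ∞ (nashCoeff j) U :=
    (contDiffOn_nashCoeff j).mono ball_subset_closedBall
  have hcont : ContinuousOn (iteratedFDerivWithin ℝ m (nashCoeff j) U) U :=
    hsmooth.continuousOn_iteratedFDerivWithin (by exact_mod_cast le_top) hUopen.uniqueDiffOn
  have hcont' : ContinuousOn (iteratedFDeriv ℝ m (nashCoeff j)) U :=
    hcont.congr fun M hM => (iteratedFDerivWithin_of_isOpen m hUopen hM).symm
  -- the closed ball of radius `c₀` is compact and contained in `U`
  have hsub : closedBall idMat nashRadius ⊆ U := by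
    intro M hM
    rw [hU, mem_ball]
    exact (mem_closedBall.mp hM).trans_lt (by norm_num [nashRadius])
  obtain ⟨C, hC⟩ := (isCompact_closedBall idMat nashRadius).exists_bound_of_continuousOn
    (hcont'.mono hsub)
  exact ⟨C, fun M hM => hC M (mem_closedBall.mpr hM)⟩

/-! ## Lemma 6.1 in its printed shape -/

/-- **Coiculescu–Palasek's Lemma 6.1 (Nash lemma), as printed**: there exist `c₀ > 0`,
`θ₁, …, θ₆ ∈ ℤ³` and functions `Γ₁, …, Γ₆`, smooth on a neighbourhood of the closed ball
`B = {M : dist M Id ≤ c₀}` (here: `C^∞` on the closed ball of radius `2c₀`), such that every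
symmetric `M ∈ B` decomposes as `M = ∑_j Γ_j(M)² θ_j ⊗ θ_j`, with `1/100 ≤ Γ_j(M) ≤ 1` on `B` and
`sup_B ‖D^m Γ_j‖ < ∞` for every `m`. Witnesses: `c₀ = nashRadius = 1/1000`, `θ = nashDir`,
`Γ = nashCoeff`. The ball is the sup-norm ball of `ℝ^{3×3}`, which contains the printed Frobenius
ball of `S^{3×3}`. [cite: CoiculescuPalasek2025, Lemma 6.1] -/
theorem nash_lemma :
    ∃ (c₀ : ℝ) (θ : Fin 6 → Fin 3 → ℤ) (Γ : Fin 6 → (Fin 3 → Fin 3 → ℝ) → ℝ), 0 < c₀ ∧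
      (∀ j, ContDiffOn ℝ ∞ (Γ j) (closedBall idMat (2 * c₀))) ∧
      (∀ M : Fin 3 → Fin 3 → ℝ, (∀ i j, M i j = M j i) → dist M idMat ≤ c₀ →
        (∀ a b, M a b = ∑ j, Γ j M ^ 2 * ((θ j a : ℝ) * (θ j b : ℝ))) ∧
          ∀ j, 1 / 100 ≤ Γ j M ∧ Γ j M ≤ 1) ∧
      ∀ j (m : ℕ), ∃ C : ℝ, ∀ M : Fin 3 → Fin 3 → ℝ, dist M idMat ≤ c₀ →
        ‖iteratedFDeriv ℝ m (Γ j) M‖ ≤ C := by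
  refine ⟨nashRadius, nashDir, nashCoeff, nashRadius_pos, fun j => ?_, fun M hsym hM => ?_,
    exists_bound_iteratedFDeriv_nashCoeff⟩
  · have : (2 * nashRadius : ℝ) = 1 / 500 := by norm_num [nashRadius]
    rw [this]
    exact contDiffOn_nashCoeff j
  · have hM' : dist M idMat ≤ 1 / 500 := hM.trans (by norm_num [nashRadius])
    exact ⟨nash_decomposition hsym hM', fun j =>
      ⟨by linarith [(nashCoeff_mem_Icc hM' j).1], (nashCoeff_mem_Icc hM' j).2⟩⟩

end Literature.Analysis.FluidPDE.CP25
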